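import Mathlib
import HarnessLib
import Summits.Ventures.LatticeQCDFlow.Exactness.LatticeSiteLocality

/-!
# Locally supported lattice polynomials are spanned by the local monomials: a volume-independent bound on their dimension

HONEST FRAMING: exact (Metropolis-corrected) sampling algorithms for lattice gauge theory;
figures of merit are autocorrelation/cost numbers at stated couplings and volumes; no
continuum-physics claim.

Venture `LatticeQCDFlow` (cell pub-lqcd), topic `Exactness`; FANOUT row 7 (`s0-cpn-null`).  NEW
WORK of the cell over Mathlib and the tree's `Exactness/LatticeSitePolynomials.lean` (`smonom`,
`polyS`) and `Exactness/LatticeSiteLocality.lean` (`sdepOn`, `polySD N A = polyS N ⊓ sdepOn A` — the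
spaces in which the local Lüscher recursion of `Exactness/SphereLuscherSeriesLocality.lean` is
solved); nothing is cited as a fact.  Printed counterpart, NAMED ONLY: M. Lüscher, Commun. Math. Phys.
293 (2010) 899, §4.4–§4.5 (each order of the flow action is a finite linear combination of local
monomials — loops of bounded extension — so the number of coefficients to be determined at a given
order does not grow with the lattice).

## Content (`E` finite-dimensional real inner product space, `d = dim E`; `Λ` finite; `A ⊆ Λ`)

* `polySA Λ E N A` — the span of the site monomials of degree `≤ N` ALL OF WHOSE FACTORS SIT IN `A`
  (indexed by `Σ k ≤ N, (Fin k → A × Fin d)`, a type that does not see `Λ ∖ A`);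
  `polySA_le_polySD` (such monomials are polynomials supported in `A`).
* `zeroOff A x` — the configuration equal to `x` on `A` and `0` elsewhere; `smonom_zeroOff` (a
  monomial evaluated at `zeroOff A x` is itself if all its factors sit in `A`, and `0` otherwise);
  **`comp_zeroOff_mem_polySA`** (`F ∈ polyS N ⇒ F ∘ zeroOff A ∈ polySA N A`);
  `eq_comp_zeroOff` (`F ∈ sdepOn A ⇒ F = F ∘ zeroOff A`).
* **`polySD_eq_polySA`** — A LATTICE POLYNOMIAL SUPPORTED IN `A` IS A COMBINATION OF `A`-MONOMIALS:
  `polyS N ⊓ sdepOn A = polySA N A` (no linear-independence argument needed: precompose with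
  `zeroOff A`).
* **`finrank_polySD_le`** — `dim (polySD N A) ≤ #(Σ k ≤ N, (Fin k → A × Fin d)) = Σ_{k ≤ N} (|A|·d)^k`
  (`card_localIndex`): THE NUMBER OF FREE REAL COEFFICIENTS OF A DEGREE-`≤ N` POLYNOMIAL SUPPORTED IN
  `A` IS BOUNDED BY A FUNCTION OF `N`, `d` AND `|A|` ONLY — for the local terms `X_n⁽ᵏ⁾ ∈
  polySD (a(k+1)) (nball N (k+1) n)` of `SphereLuscherSeriesLocality` / `…LocalityES`, a bound by the
  order, the target dimension and the size of the radius-`(k+1)` coupling ball, NOT the volume `|Λ|`.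

NOT CLAIMED: sharpness of the count (the monomials are not claimed independent); bounds on ball
sizes for particular lattices; anything quantitative beyond this dimension count.
-/

noncomputable section

namespace Summit.Ventures.LatticeQCDFlow.Exactness

open Function Set
open scoped RealInnerProductSpace

variable {Λ : Type*} {E : Type*} [NormedAddCommGroup E] [InnerProductSpace ℝ E]
  [FiniteDimensional ℝ E]

/-! ## §1 The span of the `A`-monomials -/

section LocalMonomials

variable (Λ E) in
/-- The index of the `A`-monomials of degree `≤ N`: a degree `k ≤ N` and `k` factors, each a site
of `A` with a frame direction. -/
abbrev LocalIndex (N : ℕ) (A : Set Λ) : Type _ :=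
  Σ k : Fin (N + 1), (Fin k → A × Fin (Module.finrank ℝ E))

/-- The monomial of a local index. -/
def localMonom {N : ℕ} {A : Set Λ} (p : LocalIndex Λ E N A) : (Λ → E) → ℝ :=
  smonom fun j => (((p.2 j).1 : Λ), (p.2 j).2)

variable (Λ E) in
/-- **`polySA Λ E N A`**: the span of the site monomials of degree `≤ N` all of whose factors are
coordinates of sites in `A`. -/
def polySA (N : ℕ) (A : Set Λ) : Submodule ℝ ((Λ → E) → ℝ) :=
  Submodule.span ℝ (range (localMonom (N := N) (A := A)))

/-- A monomial all of whose factors sit in `A` depends only on `A`. -/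
theorem smonom_mem_sdepOn {A : Set Λ} {k : ℕ} {κs : Fin k → SiteCoord Λ E}
    (h : ∀ j, (κs j).1 ∈ A) : smonom κs ∈ sdepOn A := fun x x' hx => by
  simp only [smonom, scoord]
  exact Finset.prod_congr rfl fun j _ => by rw [hx _ (h j)]

/-- `A`-monomials are polynomials supported in `A`: `polySA N A ≤ polySD N A`. -/
theorem polySA_le_polySD (N : ℕ) (A : Set Λ) : polySA Λ E N A ≤ polySD Λ E N A := by
  refine Submodule.span_le.2 ?_
  rintro _ ⟨⟨k, κs⟩, rfl⟩
  exact ⟨smonom_mem (Nat.lt_succ_iff.1 k.2) _, smonom_mem_sdepOn fun j => (κs j).1.2⟩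

end LocalMonomials

/-! ## §2 Precomposition with `zeroOff A` projects `polyS N` onto the `A`-monomials -/

section ZeroOff

/-- The configuration equal to `x` on `A` and `0` off `A`. -/
def zeroOff (A : Set Λ) [DecidablePred (· ∈ A)] (x : Λ → E) : Λ → E :=
  fun n => if n ∈ A then x n else 0

variable {A : Set Λ} [DecidablePred (· ∈ A)]

omit [InnerProductSpace ℝ E] [FiniteDimensional ℝ E] in
/-- On `A`, `zeroOff A x` agrees with `x`. -/
theorem zeroOff_of_mem {n : Λ} (hn : n ∈ A) (x : Λ → E) : zeroOff A x n = x n := if_pos hn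

/-- A coordinate of `zeroOff A x`: the coordinate of `x` if the site is in `A`, else `0`. -/
theorem scoord_zeroOff (κ : SiteCoord Λ E) (x : Λ → E) :
    scoord κ (zeroOff A x) = if κ.1 ∈ A then scoord κ x else 0 := by
  unfold scoord zeroOff
  split_ifs <;> simp

/-- **A monomial at `zeroOff A x`**: itself if all factors sit in `A`, and `0` otherwise. -/
theorem smonom_zeroOff {k : ℕ} (κs : Fin k → SiteCoord Λ E) (x : Λ → E) :
    smonom κs (zeroOff A x) = if ∀ j, (κs j).1 ∈ A then smonom κs x else 0 := by
  by_cases h : ∀ j, (κs j).1 ∈ A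
  · rw [if_pos h]
    simp only [smonom]
    exact Finset.prod_congr rfl fun j _ => by rw [scoord_zeroOff, if_pos (h j)]
  · rw [if_neg h]
    obtain ⟨j, hj⟩ := not_forall.1 h
    exact Finset.prod_eq_zero (Finset.mem_univ j) (by rw [scoord_zeroOff, if_neg hj])

/-- **`F ∈ polyS N ⇒ F ∘ zeroOff A ∈ polySA N A`.** -/
theorem comp_zeroOff_mem_polySA {N : ℕ} {F : (Λ → E) → ℝ} (hF : F ∈ polyS Λ E N) :
    (fun x => F (zeroOff A x)) ∈ polySA Λ E N A := by
  induction hF using Submodule.span_induction with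
  | mem f hf =>
      obtain ⟨⟨k, κs⟩, rfl⟩ := hf
      by_cases h : ∀ j, (κs j).1 ∈ A
      · have e : (fun x => smonom κs (zeroOff A x)) =
            localMonom (N := N) ⟨k, fun j => (⟨(κs j).1, h j⟩, (κs j).2)⟩ := by
          funext x; rw [smonom_zeroOff, if_pos h]; rfl
        rw [e]
        exact Submodule.subset_span ⟨_, rfl⟩
      · have e : (fun x => smonom κs (zeroOff A x)) = 0 := by
          funext x; rw [smonom_zeroOff, if_neg h]; rfl
        rw [e]
        exact Submodule.zero_mem _
  | zero => exact Submodule.zero_mem _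
  | add f g _ _ hf hg => exact Submodule.add_mem _ hf hg
  | smul c f _ hf => exact Submodule.smul_mem _ c hf

omit [InnerProductSpace ℝ E] [FiniteDimensional ℝ E] in
/-- **A functional supported in `A` equals its precomposition with `zeroOff A`.** -/
theorem eq_comp_zeroOff {F : (Λ → E) → ℝ} (hF : F ∈ sdepOn A) :
    F = fun x => F (zeroOff A x) :=
  funext fun x => hF fun _ hn => (zeroOff_of_mem hn x).symm

end ZeroOff

/-! ## §3 `polySD = polySA` and the volume-independent dimension bound -/

section Dimension

/-- `polySD N A ≤ polySA N A`: a polynomial supported in `A` is a combination of `A`-monomials. -/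
theorem polySD_le_polySA (N : ℕ) (A : Set Λ) : polySD Λ E N A ≤ polySA Λ E N A := by
  classical
  intro F hF
  rw [eq_comp_zeroOff (A := A) hF.2]
  exact comp_zeroOff_mem_polySA hF.1

/-- **A LATTICE POLYNOMIAL OF DEGREE `≤ N` SUPPORTED IN `A` IS A COMBINATION OF THE `A`-MONOMIALS OF
DEGREE `≤ N`**: `polyS N ⊓ sdepOn A = polySA N A`. -/
theorem polySD_eq_polySA (N : ℕ) (A : Set Λ) : polySD Λ E N A = polySA Λ E N A :=
  le_antisymm (polySD_le_polySA N A) (polySA_le_polySD N A)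

/-- **VOLUME-INDEPENDENT DIMENSION BOUND**: `dim polySD N A ≤ #(Σ k ≤ N, (Fin k → A × Fin d))`, a
number depending on `N`, `d = dim E` and `A` only (not on `Λ ∖ A`). -/
theorem finrank_polySD_le (N : ℕ) (A : Set Λ) [Fintype A] :
    Module.finrank ℝ (polySD Λ E N A) ≤ Fintype.card (LocalIndex Λ E N A) := by
  rw [polySD_eq_polySA]
  exact finrank_range_le_card (R := ℝ) (localMonom (N := N) (A := A))

omit [FiniteDimensional ℝ E] in
/-- The count of local indices: `#(Σ k ≤ N, (Fin k → A × Fin d)) = Σ_{k ≤ N} (|A|·d)^k`. -/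
theorem card_localIndex (N : ℕ) (A : Set Λ) [Fintype A] :
    Fintype.card (LocalIndex Λ E N A) =
      ∑ k ∈ Finset.range (N + 1), (Fintype.card A * Module.finrank ℝ E) ^ k := by
  rw [Fintype.card_sigma, Fin.sum_univ_eq_sum_range (fun k =>
    Fintype.card (Fin k → A × Fin (Module.finrank ℝ E))) (N + 1)]
  refine Finset.sum_congr rfl fun k _ => ?_
  rw [Fintype.card_fun, Fintype.card_prod, Fintype.card_fin, Fintype.card_fin]

/-- **THE NUMBER OF FREE COEFFICIENTS OF A DEGREE-`≤ N` LATTICE POLYNOMIAL SUPPORTED IN `A` IS AT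
MOST `Σ_{k ≤ N} (|A|·d)^k`** — for the local terms `X_n⁽ᵏ⁾ ∈ polySD (a(k+1)) (nball N (k+1) n)` of
the Lüscher series this is a bound by the order, `dim E` and the size of the radius-`(k+1)` ball,
independent of the lattice volume. -/
theorem finrank_polySD_le_sum (N : ℕ) (A : Set Λ) [Fintype A] :
    Module.finrank ℝ (polySD Λ E N A) ≤
      ∑ k ∈ Finset.range (N + 1), (Fintype.card A * Module.finrank ℝ E) ^ k := by
  rw [← card_localIndex]
  exact finrank_polySD_le N A

end Dimension

end Summit.Ventures.LatticeQCDFlow.Exactness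

end
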